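import Mathlib
import Summits.NavierStokesRegularity.NavierStokesRegularity.Theorems.EulerZoomLiouvillePowerGaugeEulerLiouvilleNeedleStagnationKinematics
import Literature.Analysis.FluidPDE.SelfSimilarEulerOutgoingExclusionTools

/-!
# Crux `EulerZoomLiouville.PowerGaugeEulerLiouville` (stmt-NavierStokesRegularity-19832), THE ONE STATEMENT `stub_selfSimilarC2Needle`:
# HOSTS ARE SADDLES — wherever a unit stretching rate reaches `1`, some direction is compressed by the TRANSPORT at rate `½ − γ = ργ/2`;
# and where the transport linearisation is non-negative (a source of `W`), every stretching rate is `≤ 2γ < 1`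

ROUND-41 (nsreg-p2 g33), census (E3)(b)(c) and (E4).  `W = γy + U`, `DW = γ·id + DU`, `tr DU = 0`.  Pure linear algebra over the profile's incompressibility, valid at EVERY
point `z` (stagnation or not), built on the tree's trace inequality `Literature.Analysis.FluidPDE.inner_apply_self_le_trace_sub_mul` (CIV §3.5):
* `inner_fderiv_le_two_mul_of_transport_nonneg` — `⟪DW v, v⟫ ≥ 0 ∀v` ⇒ `⟪DU w, w⟫ ≤ 2γ‖w‖²` (SOURCES ARE SUBCRITICAL; for local maxima of `ℋ` this is the tree's
  `IsSelfSimilarEulerProfile.inner_fderiv_le_of_isLocalMax_selfSimilarBernoulli`);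
* `exists_inner_fderiv_le_neg_half_of_stretching_ge_one` — `‖w‖² ≤ ⟪DU w, w⟫` for some `w ≠ 0` ⇒ `∃ v, ‖v‖ = 1 ∧ ⟪DU v, v⟫ ≤ −½` (compactness of the unit sphere
  + the trace inequality; generalises t40e `exists_inner_fderiv_le_neg_half_of_stagnation`, the case `w = Ω(z)` at a vortical stagnation point);
* `exists_inner_transport_le_of_stretching_ge_one` — hence `∃ v, ‖v‖ = 1 ∧ ⟪DW v, v⟫ ≤ γ − ½`: a CRITICALLY STRETCHED point is a saddle of the transport with a
  compressed direction of rate `½ − γ`, `= ργ/2` for `γ = 1/(2+ρ)` (`half_sub_inv_two_add`); `exists_inner_transport_le_of_vortical_stagnation` — in particular at every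
  VORTICAL stagnation point.
Reading (R41 §1): by the stretching criterion a host of hovering vortical labels is critically stretched on time-average, so it is never a source and always carries the
universal backward-repelling rate `ργ/2` of the cocycle law (L4).

WHAT THIS IS NOT: not NS, not E — linear algebra for THE ONE STATEMENT; 19832 is OPEN.  [folklore; ConstantinIgnatovaVicol2026Putative §3.5]
-/

noncomputable section

set_option linter.dupNamespace false

open Set Metric Function InnerProductSpace
open scoped RealInnerProductSpace

namespace Summit.NavierStokesRegularity.NavierStokesRegularity.Theorems.PowerGaugeEulerLiouville.Stagnation

open Literature.Analysis Literature.Analysis.FluidPDE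

variable {γ : ℝ} {U : (EuclideanSpace ℝ (Fin 3)) → (EuclideanSpace ℝ (Fin 3))} {P : (EuclideanSpace ℝ (Fin 3)) → ℝ}

/-- The transport quadratic form: `⟪DW(z) v, v⟫ = γ‖v‖² + ⟪DU(z) v, v⟫`. -/
theorem inner_fderiv_transport_self {z : EuclideanSpace ℝ (Fin 3)} (hU : DifferentiableAt ℝ U z) (v : EuclideanSpace ℝ (Fin 3)) :
    ⟪fderiv ℝ (selfSimilarTransport γ 0 U) z v, v⟫ = γ * ‖v‖ ^ 2 + ⟪fderiv ℝ U z v, v⟫ := by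
  rw [fderiv_selfSimilarTransport (γ := γ) hU, _root_.add_apply, _root_.smul_apply, ContinuousLinearMap.id_apply,
    inner_add_left, real_inner_smul_left, real_inner_self_eq_norm_sq]

/-- **SOURCES ARE SUBCRITICAL.**  If the transport linearisation at `z` is non-negative, `⟪DW(z) v, v⟫ ≥ 0` for all `v` (e.g. a node of `W` attracting an open set of
labels backward, or a local maximum of `ℋ`), then every stretching rate is at most `2γ`: `⟪DU(z) w, w⟫ ≤ 2γ‖w‖²` (`< ‖w‖²` in the window `γ < ½`).
[cite: ConstantinIgnatovaVicol2026Putative, §3.5] -/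
theorem inner_fderiv_le_two_mul_of_transport_nonneg (hprof : IsSelfSimilarEulerProfile γ 0 U P) {z : EuclideanSpace ℝ (Fin 3)}
    (hpsd : ∀ v, 0 ≤ ⟪fderiv ℝ (selfSimilarTransport γ 0 U) z v, v⟫) (w : EuclideanSpace ℝ (Fin 3)) :
    ⟪fderiv ℝ U z w, w⟫ ≤ 2 * γ * ‖w‖ ^ 2 := by
  have hUd : Differentiable ℝ U := hprof.contDiff_velocity.differentiable (by norm_num)
  have hq : ∀ v : EuclideanSpace ℝ (Fin 3), -γ * ‖v‖ ^ 2 ≤ ⟪fderiv ℝ U z v, v⟫ := by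
    intro v
    have h0 := hpsd v
    rw [inner_fderiv_transport_self (hUd z)] at h0
    linarith
  have htr := inner_apply_self_le_trace_sub_mul hq w
  have hdiv : LinearMap.trace ℝ _ (fderiv ℝ U z :
      EuclideanSpace ℝ (Fin 3) →ₗ[ℝ] EuclideanSpace ℝ (Fin 3)) = 0 := hprof.divFree z
  rw [hdiv, finrank_euclideanSpace, Fintype.card_fin] at htr
  norm_num at htr
  linarith

/-- **CRITICAL STRETCHING FORCES COMPRESSION `≤ −½`.**  If some `w ≠ 0` is stretched at rate `≥ 1`, `‖w‖² ≤ ⟪DU(z) w, w⟫`, then some unit `v` has `⟪DU(z) v, v⟫ ≤ −½`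
(the minimum `q` of the form on the unit sphere satisfies `⟪DU w, w⟫ ≤ −2q‖w‖²` by `tr DU = 0`). [folklore] -/
theorem exists_inner_fderiv_le_neg_half_of_stretching_ge_one (hprof : IsSelfSimilarEulerProfile γ 0 U P) {z w : EuclideanSpace ℝ (Fin 3)}
    (hw : w ≠ 0) (h1 : ‖w‖ ^ 2 ≤ ⟪fderiv ℝ U z w, w⟫) :
    ∃ v : EuclideanSpace ℝ (Fin 3), ‖v‖ = 1 ∧ ⟪fderiv ℝ U z v, v⟫ ≤ -(1 / 2) := by
  set A : EuclideanSpace ℝ (Fin 3) →L[ℝ] EuclideanSpace ℝ (Fin 3) := fderiv ℝ U z with hA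
  -- the form attains its minimum `q` on the unit sphere
  have hcpt : IsCompact (sphere (0 : EuclideanSpace ℝ (Fin 3)) 1) := isCompact_sphere 0 1
  have hwn : ‖w‖ ≠ 0 := norm_ne_zero_iff.2 hw
  have hne : (sphere (0 : EuclideanSpace ℝ (Fin 3)) 1).Nonempty :=
    ⟨‖w‖⁻¹ • w, by rw [mem_sphere_zero_iff_norm, norm_smul, norm_inv, norm_norm, inv_mul_cancel₀ hwn]⟩
  have hcont : Continuous fun v : EuclideanSpace ℝ (Fin 3) => ⟪A v, v⟫ := (A.continuous.inner continuous_id)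
  obtain ⟨v₀, hv₀, hmin⟩ := hcpt.exists_isMinOn hne hcont.continuousOn
  have hv₀1 : ‖v₀‖ = 1 := mem_sphere_zero_iff_norm.1 hv₀
  set q : ℝ := ⟪A v₀, v₀⟫ with hq
  -- homogeneity: `q‖v‖² ≤ ⟪A v, v⟫` for every `v`
  have hqv : ∀ v : EuclideanSpace ℝ (Fin 3), q * ‖v‖ ^ 2 ≤ ⟪A v, v⟫ := by
    intro v
    by_cases hv : v = 0
    · simp [hv]
    have hvn : ‖v‖ ≠ 0 := norm_ne_zero_iff.2 hv
    have hvpos : 0 < ‖v‖ := norm_pos_iff.2 hv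
    have hmem : ‖v‖⁻¹ • v ∈ sphere (0 : EuclideanSpace ℝ (Fin 3)) 1 := by
      rw [mem_sphere_zero_iff_norm, norm_smul, norm_inv, norm_norm, inv_mul_cancel₀ hvn]
    have hle := hmin hmem
    simp only [mem_setOf_eq] at hle
    rw [map_smul, real_inner_smul_left, real_inner_smul_right] at hle
    -- `hle : q ≤ ‖v‖⁻¹ * (‖v‖⁻¹ * ⟪A v, v⟫)`
    have h2 : ‖v‖⁻¹ * (‖v‖⁻¹ * ⟪A v, v⟫) = ⟪A v, v⟫ / ‖v‖ ^ 2 := by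
      field_simp
    rw [h2, le_div_iff₀ (by positivity)] at hle
    exact hle
  have htr := inner_apply_self_le_trace_sub_mul hqv w
  have hdiv : LinearMap.trace ℝ _ (A : EuclideanSpace ℝ (Fin 3) →ₗ[ℝ] EuclideanSpace ℝ (Fin 3)) = 0 := hprof.divFree z
  rw [hdiv, finrank_euclideanSpace, Fintype.card_fin] at htr
  norm_num at htr
  -- `htr : ⟪A w, w⟫ ≤ -(2 * q * ‖w‖²)`-ish; combine with `h1`
  have hwpos : 0 < ‖w‖ ^ 2 := by positivity
  refine ⟨v₀, hv₀1, ?_⟩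
  rw [← hq]
  nlinarith [h1, htr, hwpos]

/-- **HOSTS ARE SADDLES.**  If some `w ≠ 0` is stretched at rate `≥ 1` at `z`, then the transport `W = γy + U` compresses some unit direction at rate `½ − γ`:
`∃ v, ‖v‖ = 1 ∧ ⟪DW(z) v, v⟫ ≤ γ − ½` (`< 0` in the window; `= −ργ/2` for `γ = 1/(2+ρ)`).  For the BACKWARD flow this direction is repelling. [folklore] -/
theorem exists_inner_transport_le_of_stretching_ge_one (hprof : IsSelfSimilarEulerProfile γ 0 U P) {z w : EuclideanSpace ℝ (Fin 3)}
    (hw : w ≠ 0) (h1 : ‖w‖ ^ 2 ≤ ⟪fderiv ℝ U z w, w⟫) :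
    ∃ v : EuclideanSpace ℝ (Fin 3), ‖v‖ = 1 ∧ ⟪fderiv ℝ (selfSimilarTransport γ 0 U) z v, v⟫ ≤ γ - 1 / 2 := by
  have hUd : Differentiable ℝ U := hprof.contDiff_velocity.differentiable (by norm_num)
  obtain ⟨v, hv1, hv⟩ := exists_inner_fderiv_le_neg_half_of_stretching_ge_one hprof hw h1
  refine ⟨v, hv1, ?_⟩
  rw [inner_fderiv_transport_self (hUd z), hv1]
  linarith

/-- **Every VORTICAL stagnation point is a saddle of the transport**: `∃ v, ‖v‖ = 1 ∧ ⟪DW(z) v, v⟫ ≤ γ − ½` (the direction `Ω(z)` is stretched at rate exactly `1`,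
t40e `inner_fderiv_unitCurl_of_stagnation`). [folklore] -/
theorem exists_inner_transport_le_of_vortical_stagnation (hprof : IsSelfSimilarEulerProfile γ 0 U P) {z : EuclideanSpace ℝ (Fin 3)}
    (hz : selfSimilarTransport γ 0 U z = 0) (hΩ : curl U z ≠ 0) :
    ∃ v : EuclideanSpace ℝ (Fin 3), ‖v‖ = 1 ∧ ⟪fderiv ℝ (selfSimilarTransport γ 0 U) z v, v⟫ ≤ γ - 1 / 2 := by
  refine exists_inner_transport_le_of_stretching_ge_one hprof hΩ (le_of_eq ?_)
  rw [fderiv_apply_curl_of_stagnation hprof hz, real_inner_self_eq_norm_sq]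

/-- The universal rate: for `γ = 1/(2+ρ)`, `½ − γ = (ρ/2)·γ` (so the compressed rate `γ − ½` above is `−ργ/2`, the exponent of the cocycle law (L4)). -/
theorem half_sub_inv_two_add {ρ : ℝ} (hρ : 0 < ρ) : 1 / 2 - 1 / (2 + ρ) = ρ / 2 * (1 / (2 + ρ)) := by
  have h : (2 + ρ) ≠ 0 := by linarith
  field_simp
  ring

end Summit.NavierStokesRegularity.NavierStokesRegularity.Theorems.PowerGaugeEulerLiouville.Stagnation
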